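import Literature.AlgebraicGeometry.Resolution.MonomialOrderReductionCanonical
import Literature.AlgebraicGeometry.Resolution.BoundaryEquivalence
import Literature.AlgebraicGeometry.Resolution.BlowupSequencesPruneMarked
import Literature.AlgebraicGeometry.Resolution.BlowupSequencesComapMarked
import Literature.AlgebraicGeometry.Resolution.KollarTripleEtaleCover
import HarnessLib

/-!
# Functoriality of Kollár's deterministic Step 3 (Kollár 2007, 3.111 Step 3 with 3.34.1–3.34.2 and 3.32)

Topic: `Literature/AlgebraicGeometry/Resolution`. Sequel to `MonomialOrderReductionCanonical.lean`
(the canonical blow-up sequence `monoSeq X E m` of a marked monomial ideal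
`(X, Π_j 𝓘_{E^j}^{a_j}, (E^j)_j, m)`: Kollár's Step 3 of (3.111) with his deterministic choice
of centres; J. Kollár, *Lectures on Resolution of Singularities*, Ann. of Math. Stud. 166
(2007), pp. 177–178 of the held copy). Kollár closes Step 3 with "The functoriality conditions
are just as obvious as before" — the conditions being those of the blow-up sequence functors
of Thm. 3.107: commutation with smooth morphisms (3.34.1: for a smooth `h : Y → X`, the sequence
of `(Y, h^*I, h^{-1}E)` is the pull-back `h^*` of the sequence of `(X, I, E)` with the empty
blow-ups deleted, and the pull-back itself when `h` is surjective), with change of fields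
(3.34.2), and independence of the empty members of the ordered boundary (3.32). This file PROVES
them for `monoSeq`, at the level of the data `(X, (E^j, a_j)_j, m)` and for every FLAT morphism
`f : X' → X` (which covers smooth morphisms, open immersions and changes of fields alike),
assuming simple normal crossings on both sides:

* `comapExp E f` — the pulled-back exponent list `(f^*E^j, a_j)_j`; `monomialMarked_comapExp`
  (its marked monomial ideal is `f^*` of that of `E`), `weightAt_comapExp`,
  **`comapExp_transformExp`** (transforming and pulling back commute along the cartesian
  square of blow-ups, `comap_strictTransformIdeal_of_flat`);
* `nonTop E` — the entries with non-empty divisor; **`monoSeq_eq_of_nonTop_eq`** — **the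
  canonical sequence ignores the empty members of the ordered boundary** (3.32 / Notation 3.64
  (3): two exponent lists with the same non-`⊤` entries in the same order have the same
  canonical sequence; the choice only involves sets of divisors with a common point, their
  weights, and the relative order of first occurrences, `Finset.Colex.toColex_le_toColex`);
* **`monoSeq_comap_of_surjective`** — **for `f` flat and surjective,
  `(monoSeq X E m).comap f = monoSeq X' (comapExp E f) m`** (3.34.1, first bullet; 3.34.2):
  strata, weights, phases and codes correspond exactly (a set of divisors with a common point
  upstairs is the pull-back of a unique such set downstairs — faithful flatness of the local
  rings and the stalkwise injectivity of an snc boundary, `HasSNCWith.injOn_stalkIdeal`);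
* **`comap_monoSeq_isExtensionOf`** — **for `f` flat, `(monoSeq X E m).comap f` is an
  extension (BGMW Def. 3.1.5) of `monoSeq X' (comapExp E f) m`** (3.34.1, second bullet): a
  canonical centre downstairs either pulls back to the canonical centre upstairs, or to the
  empty centre — a trivial step, after which the upstairs list has acquired an empty member,
  invisible to the canonical sequence (`monoSeq_eq_of_nonTop_eq`), and the comparison
  continues along the isomorphism `Bl_∅ X' → X'` (`monoSeq_comap_of_surjective`);
  corollaries `prune_comap_monoSeq` (Kollár's form: delete the empty blow-ups),
  `restrict_monoSeq_isExtensionOf` (open immersions), and `noEmptyCentres_monoSeq` (3.32).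

## Sources

* J. Kollár, *Lectures on Resolution of Singularities*, Ann. of Math. Stud. 166 (2007):
  (3.111) Step 3 (pp. 177–178), 3.32 and 3.34.1–3.34.2 (pp. 130–131), Notation 3.64 (p. 148),
  Thm. 3.107 (p. 175) of the held copy. [Kollar2007]
* E. Bierstone, D. Grigoriev, P. Milman, J. Włodarczyk, arXiv:1206.3090, Def. 3.1.5
  (extensions), Thm. 8.0.5 (1)–(2) (induced sequences along étale morphisms), §4 Step 2b.
  [BierstoneGrigorievMilmanWlodarczyk2011]
-/

noncomputable section

open CategoryTheory AlgebraicGeometry TopologicalSpace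

namespace Literature.AlgebraicGeometry.Resolution

universe u

/-! ## Two combinatorial lemmas: first occurrences in a filtered list; dual-colex codes -/

section Combinatorics

/-- Filtering a list by a predicate satisfied by `a` and `b` does not change the relative order
of their first occurrences. [folklore] -/
theorem List.idxOf_lt_idxOf_iff_filter {α : Type*} [DecidableEq α] (q : α → Bool) :
    ∀ (l : List α) {a b : α}, a ∈ l → b ∈ l → q a = true → q b = true →
      (l.idxOf a < l.idxOf b ↔ (l.filter q).idxOf a < (l.filter q).idxOf b)
  | [], _, _, ha, _, _, _ => absurd ha List.not_mem_nil
  | c :: l, a, b, ha, hb, hqa, hqb => by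
    by_cases hca : c = a
    · subst hca
      by_cases hcb : c = b
      · subst hcb
        simp
      · rw [List.filter_cons_of_pos hqa]
        simp [hcb]
    · have ha' : a ∈ l := (List.mem_cons.mp ha).resolve_left (Ne.symm hca)
      by_cases hcb : c = b
      · subst hcb
        rw [List.filter_cons_of_pos hqb]
        simp [hca]
      · have hb' : b ∈ l := (List.mem_cons.mp hb).resolve_left (Ne.symm hcb)
        have ih := List.idxOf_lt_idxOf_iff_filter q l ha' hb' hqa hqb
        by_cases hqc : q c = true
        · rw [List.filter_cons_of_pos hqc]
          simpa [List.idxOf_cons, hca, hcb] using ih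
        · rw [List.filter_cons_of_neg hqc]
          simpa [List.idxOf_cons, hca, hcb] using ih

/-- First occurrences in a mapped list, for a map separating `a` from the other members.
[folklore] -/
theorem List.idxOf_map_of_forall_eq {α β : Type*} [DecidableEq α] [DecidableEq β] (g : α → β) :
    ∀ (l : List α) {a : α}, (∀ a' ∈ l, g a' = g a → a' = a) → (l.map g).idxOf (g a) = l.idxOf a
  | [], _, _ => by simp
  | c :: l, a, h => by
    by_cases hca : c = a
    · subst hca
      simp
    · have hg : g c ≠ g a := fun heq => hca (h c List.mem_cons_self heq)
      rw [List.map_cons, List.idxOf_cons, List.idxOf_cons]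
      simp only [beq_eq_decide, hg, decide_false, cond_false, hca,
        List.idxOf_map_of_forall_eq g l fun a' ha' => h a' (List.mem_cons_of_mem c ha')]

/-- **The dual-colex comparison of the codes of two finite sets under a ranking injective on
their union, in terms of memberships and the ranking only**: `code S₁ ≤ code S₂` iff every
member of `S₁ ∖ S₂` is preceded (weakly) by some member of `S₂ ∖ S₁`.
[cite: Kollar2007, (3.111) Step 3 ("lexicographically smallest")] -/
theorem toColex_image_toDual_le_iff {α : Type*} [DecidableEq α] (S₁ S₂ : Finset α) (g : α → ℕ)
    (hinj : ∀ a ∈ S₁ ∪ S₂, ∀ b ∈ S₁ ∪ S₂, g a = g b → a = b) :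
    toColex (S₁.image fun a => OrderDual.toDual (g a)) ≤ toColex (S₂.image fun a => OrderDual.toDual (g a)) ↔
      ∀ a ∈ S₁, a ∉ S₂ → ∃ b ∈ S₂, b ∉ S₁ ∧ g b ≤ g a := by
  rw [Finset.Colex.toColex_le_toColex]
  have key : ∀ {S S' : Finset α}, (∀ a ∈ S ∪ S', ∀ b ∈ S ∪ S', g a = g b → a = b) →
      ∀ {a : α}, a ∈ S → (OrderDual.toDual (g a) ∈ S'.image (fun a => OrderDual.toDual (g a)) ↔ a ∈ S') := by
    intro S S' hSS' a ha
    constructor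
    · intro hmem
      obtain ⟨b, hb, hba⟩ := Finset.mem_image.mp hmem
      have hgb : g b = g a := OrderDual.toDual.injective hba
      rwa [← hSS' b (Finset.mem_union_right _ hb) a (Finset.mem_union_left _ ha) hgb]
    · intro ha'
      exact Finset.mem_image_of_mem _ ha'
  have hinj' : ∀ a ∈ S₂ ∪ S₁, ∀ b ∈ S₂ ∪ S₁, g a = g b → a = b := fun a ha b hb =>
    hinj a (by rwa [Finset.union_comm]) b (by rwa [Finset.union_comm])
  constructor
  · intro h a ha hna
    have hmem : OrderDual.toDual (g a) ∈ S₁.image fun a => OrderDual.toDual (g a) :=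
      Finset.mem_image_of_mem _ ha
    have hnmem : OrderDual.toDual (g a) ∉ S₂.image fun a => OrderDual.toDual (g a) :=
      fun h' => hna ((key hinj ha).mp h')
    obtain ⟨y, hy, hyn, hle⟩ := h hmem hnmem
    obtain ⟨b, hb, rfl⟩ := Finset.mem_image.mp hy
    exact ⟨b, hb, fun hb₁ => hyn ((key hinj' hb).mpr hb₁), OrderDual.toDual_le_toDual.mp hle⟩
  · intro h y hy hyn
    obtain ⟨a, ha, rfl⟩ := Finset.mem_image.mp hy
    have hna : a ∉ S₂ := fun ha₂ => hyn ((key hinj ha).mpr ha₂)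
    obtain ⟨b, hb, hbn, hle⟩ := h a ha hna
    exact ⟨OrderDual.toDual (g b), Finset.mem_image_of_mem _ hb,
      fun h' => hbn ((key hinj' hb).mp h'), OrderDual.toDual_le_toDual.mpr hle⟩

/-- **Order-equivalent rankings give the same code comparisons** (the codes compare sets through
memberships and comparisons of ranks only). [cite: Kollar2007, (3.111) Step 3] -/
theorem toColex_image_toDual_le_iff_of_forall_lt_iff {α : Type*} [DecidableEq α] (S₁ S₂ : Finset α)
    (g₁ g₂ : α → ℕ) (h₁ : ∀ a ∈ S₁ ∪ S₂, ∀ b ∈ S₁ ∪ S₂, g₁ a = g₁ b → a = b)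
    (h₂ : ∀ a ∈ S₁ ∪ S₂, ∀ b ∈ S₁ ∪ S₂, g₂ a = g₂ b → a = b)
    (hiff : ∀ a ∈ S₁ ∪ S₂, ∀ b ∈ S₁ ∪ S₂, (g₁ a < g₁ b ↔ g₂ a < g₂ b)) :
    (toColex (S₁.image fun a => OrderDual.toDual (g₁ a)) ≤ toColex (S₂.image fun a => OrderDual.toDual (g₁ a)) ↔
      toColex (S₁.image fun a => OrderDual.toDual (g₂ a)) ≤ toColex (S₂.image fun a => OrderDual.toDual (g₂ a))) := by
  rw [toColex_image_toDual_le_iff S₁ S₂ g₁ h₁, toColex_image_toDual_le_iff S₁ S₂ g₂ h₂]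
  have hle : ∀ a ∈ S₁ ∪ S₂, ∀ b ∈ S₁ ∪ S₂, (g₁ b ≤ g₁ a ↔ g₂ b ≤ g₂ a) := fun a ha b hb => by
    rw [← not_lt, ← not_lt, hiff a ha b hb]
  constructor
  · intro h a ha hna
    obtain ⟨b, hb, hbn, hba⟩ := h a ha hna
    exact ⟨b, hb, hbn, (hle a (Finset.mem_union_left _ ha) b (Finset.mem_union_right _ hb)).mp hba⟩
  · intro h a ha hna
    obtain ⟨b, hb, hbn, hba⟩ := h a ha hna
    exact ⟨b, hb, hbn, (hle a (Finset.mem_union_left _ ha) b (Finset.mem_union_right _ hb)).mpr hba⟩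

end Combinatorics

/-! ## Pulled-back exponent lists -/

section ComapExp

variable {X X' : Scheme.{u}}

/-- **The pulled-back exponent list `(f^*E^j, a_j)_j`** (Kollár 3.30.1 / 3.34: `h^{-1}(E)` with
the same coefficients). [cite: Kollar2007, 3.34.1 (p. 131)] -/
def comapExp (E : List (X.IdealSheafData × ℕ)) (f : X' ⟶ X) : List (X'.IdealSheafData × ℕ) :=
  E.map fun p => (p.1.comap f, p.2)

/-- Unfolding. [folklore] -/
@[simp] theorem comapExp_nil (f : X' ⟶ X) : comapExp ([] : List (X.IdealSheafData × ℕ)) f = [] := rfl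

/-- Unfolding. [folklore] -/
@[simp] theorem comapExp_cons (p : X.IdealSheafData × ℕ) (E : List (X.IdealSheafData × ℕ)) (f : X' ⟶ X) :
    comapExp (p :: E) f = (p.1.comap f, p.2) :: comapExp E f := rfl

/-- `comapExp` is additive in the list. [folklore] -/
@[simp] theorem comapExp_append (E E' : List (X.IdealSheafData × ℕ)) (f : X' ⟶ X) :
    comapExp (E ++ E') f = comapExp E f ++ comapExp E' f := by
  simp [comapExp]

/-- The boundary of the pulled-back list is the list of pulled-back divisors. [folklore] -/
theorem boundaryOf_comapExp (E : List (X.IdealSheafData × ℕ)) (f : X' ⟶ X) :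
    boundaryOf (comapExp E f) = (boundaryOf E).map fun K => K.comap f := by
  simp [comapExp, boundaryOf, List.map_map, Function.comp_def]

/-- Membership in the pulled-back boundary. [folklore] -/
theorem mem_boundaryOf_comapExp_iff {E : List (X.IdealSheafData × ℕ)} {f : X' ⟶ X} {K' : X'.IdealSheafData} :
    K' ∈ boundaryOf (comapExp E f) ↔ ∃ K ∈ boundaryOf E, K.comap f = K' := by
  rw [boundaryOf_comapExp, List.mem_map]

/-- **`f^*(Π_j 𝓘_{E^j}^{a_j}) = Π_j (f^*𝓘_{E^j})^{a_j}`** (inverse images of ideal sheaves are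
multiplicative). [folklore] -/
theorem monomialIdeal_comapExp (E : List (X.IdealSheafData × ℕ)) (f : X' ⟶ X) :
    monomialIdeal (comapExp E f) = (monomialIdeal E).comap f := by
  induction E with
  | nil => rw [comapExp_nil, monomialIdeal_nil, monomialIdeal_nil, Scheme.IdealSheafData.comap_top]
  | cons p E ih => rw [comapExp_cons, monomialIdeal_cons, monomialIdeal_cons, comap_mul, comap_pow, ih]

/-- **The marked monomial ideal of the pulled-back list is the pull-back `f^*` of the marked
monomial ideal** (`MarkedIdeal.comap`). [cite: Kollar2007, 3.34.1 (p. 131)] -/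
theorem monomialMarked_comapExp (E : List (X.IdealSheafData × ℕ)) (f : X' ⟶ X) (m : ℕ) :
    monomialMarked (comapExp E f) m = (monomialMarked E m).comap f := by
  rw [monomialMarked, monomialIdeal_comapExp, boundaryOf_comapExp]
  rfl

/-- The weight at a point upstairs is the weight at its image. [folklore] -/
theorem weightAt_comapExp (E : List (X.IdealSheafData × ℕ)) (f : X' ⟶ X) (x' : X') :
    weightAt (comapExp E f) x' = weightAt E (f x') := by
  induction E with
  | nil => simp
  | cons p E ih =>
    rw [comapExp_cons]
    by_cases hx : f x' ∈ p.1.support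
    · have hx' : x' ∈ (p.1.comap f).support := by
        show x' ∈ ((p.1.comap f).support : Set X')
        rw [Scheme.IdealSheafData.support_comap]
        exact hx
      rw [weightAt_cons_of_mem E hx, weightAt_cons_of_mem (comapExp E f) hx', ih]
    · have hx' : x' ∉ (p.1.comap f).support := by
        intro h
        apply hx
        have h' : x' ∈ ((p.1.comap f).support : Set X') := h
        rwa [Scheme.IdealSheafData.support_comap] at h'
      rw [weightAt_cons_of_not_mem E hx, weightAt_cons_of_not_mem (comapExp E f) hx', ih]

/-- **The support upstairs is the preimage of the support** (snc on both sides).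
[cite: Kollar2007, 3.34.1 (p. 131)] -/
theorem mem_support_monomialMarked_comapExp_iff {E : List (X.IdealSheafData × ℕ)} {f : X' ⟶ X}
    (hE : HasSNC (boundaryOf E)) (hE' : HasSNC (boundaryOf (comapExp E f))) (m : ℕ) (x' : X') :
    x' ∈ (monomialMarked (comapExp E f) m).support ↔ f x' ∈ (monomialMarked E m).support := by
  rw [mem_support_monomialMarked_iff hE', mem_support_monomialMarked_iff hE, weightAt_comapExp]

end ComapExp

/-! ## Entries with non-empty divisor -/

section NonTop

variable {X : Scheme.{u}}

/-- **The entries of the exponent list with non-empty divisor** (empty members of the ordered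
boundary are to be ignored, 3.32 / Notation 3.64 (3)). [cite: Kollar2007, 3.32 (p. 130)] -/
def nonTop (E : List (X.IdealSheafData × ℕ)) : List (X.IdealSheafData × ℕ) := by
  classical exact E.filter fun p => p.1 ≠ ⊤

/-- Membership in `nonTop`. [folklore] -/
theorem mem_nonTop_iff {E : List (X.IdealSheafData × ℕ)} {p : X.IdealSheafData × ℕ} :
    p ∈ nonTop E ↔ p ∈ E ∧ p.1 ≠ ⊤ := by
  classical
  simp only [nonTop, List.mem_filter, decide_eq_true_eq]

/-- `nonTop` of an append. [folklore] -/
theorem nonTop_append (E E' : List (X.IdealSheafData × ℕ)) : nonTop (E ++ E') = nonTop E ++ nonTop E' := by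
  classical
  simp only [nonTop, List.filter_append]

/-- The boundary of `nonTop E` is the boundary with its empty members removed. [folklore] -/
theorem boundaryOf_nonTop (E : List (X.IdealSheafData × ℕ)) :
    boundaryOf (nonTop E) = by classical exact (boundaryOf E).filter fun K => K ≠ ⊤ := by
  classical
  simp only [nonTop, boundaryOf, List.filter_map]
  rfl

/-- A non-empty divisor is listed iff it is listed among the non-empty ones. [folklore] -/
theorem mem_boundaryOf_iff_mem_boundaryOf_nonTop {E : List (X.IdealSheafData × ℕ)}
    {K : X.IdealSheafData} (hK : K ≠ ⊤) : K ∈ boundaryOf E ↔ K ∈ boundaryOf (nonTop E) := by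
  classical
  rw [boundaryOf_nonTop]
  simp only [List.mem_filter, decide_eq_true_eq]
  exact ⟨fun h => ⟨h, hK⟩, fun h => h.1⟩

/-- Lists with the same non-empty entries list the same non-empty divisors. [folklore] -/
theorem mem_boundaryOf_iff_of_nonTop_eq {E E' : List (X.IdealSheafData × ℕ)} (h : nonTop E = nonTop E')
    {K : X.IdealSheafData} (hK : K ≠ ⊤) : K ∈ boundaryOf E ↔ K ∈ boundaryOf E' := by
  rw [mem_boundaryOf_iff_mem_boundaryOf_nonTop (E := E) hK,
    mem_boundaryOf_iff_mem_boundaryOf_nonTop (E := E') hK, h]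

/-- Empty members do not contribute to the weight of a set of non-empty divisors. [folklore] -/
theorem weightOf_nonTop (E : List (X.IdealSheafData × ℕ)) {T : Finset X.IdealSheafData} (hT : ⊤ ∉ T) :
    weightOf (nonTop E) T = weightOf E T := by
  classical
  induction E with
  | nil => simp [nonTop]
  | cons p E ih =>
    by_cases hp : p.1 ≠ ⊤
    · have hcons : nonTop (p :: E) = p :: nonTop E := by
        unfold nonTop
        exact List.filter_cons_of_pos (by simpa using hp)
      rw [hcons, weightOf_cons, weightOf_cons, ih]
    · push Not at hp
      have hcons : nonTop (p :: E) = nonTop E := by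
        unfold nonTop
        exact List.filter_cons_of_neg (by simp [hp])
      have hpT : p.1 ∉ T := hp ▸ hT
      rw [hcons, weightOf_cons, if_neg hpT, zero_add, ih]

/-- Lists with the same non-empty entries give the same weights to sets of non-empty divisors.
[folklore] -/
theorem weightOf_eq_of_nonTop_eq {E E' : List (X.IdealSheafData × ℕ)} (h : nonTop E = nonTop E')
    {T : Finset X.IdealSheafData} (hT : ⊤ ∉ T) : weightOf E T = weightOf E' T := by
  rw [← weightOf_nonTop E hT, ← weightOf_nonTop E' hT, h]

/-- A set of divisors with a common point contains no empty divisor. [folklore] -/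
theorem top_notMem_of_hasCommonPoint {T : Finset X.IdealSheafData} (hc : HasCommonPoint T) : ⊤ ∉ T := by
  obtain ⟨x, hx⟩ := hc
  intro htop
  have h := hx ⊤ htop
  rw [Scheme.IdealSheafData.support_top] at h
  exact (h : x ∈ (⊥ : Closeds X)).elim

/-- **Lists with the same non-empty entries have the same sets of divisors with a common point.**
[folklore] -/
theorem incSubsets_eq_of_nonTop_eq {E E' : List (X.IdealSheafData × ℕ)} (h : nonTop E = nonTop E') (r : ℕ) :
    incSubsets E r = incSubsets E' r := by
  ext T
  rw [mem_incSubsets_iff, mem_incSubsets_iff]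
  have key : ∀ {F F' : List (X.IdealSheafData × ℕ)}, nonTop F = nonTop F' → HasCommonPoint T →
      T ⊆ sheaves F → T ⊆ sheaves F' := by
    intro F F' hFF' hc hsub K hK
    have hKt : K ≠ ⊤ := fun htop => top_notMem_of_hasCommonPoint hc (htop ▸ hK)
    exact mem_sheaves_iff.mpr ((mem_boundaryOf_iff_of_nonTop_eq hFF' hKt).mp (mem_sheaves_iff.mp (hsub hK)))
  constructor
  · rintro ⟨hsub, hcard, hc⟩
    exact ⟨key h hc hsub, hcard, hc⟩
  · rintro ⟨hsub, hcard, hc⟩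
    exact ⟨key h.symm hc hsub, hcard, hc⟩

/-- Same `m_r`. [folklore] -/
theorem maxWeight_eq_of_nonTop_eq {E E' : List (X.IdealSheafData × ℕ)} (h : nonTop E = nonTop E') (r : ℕ) :
    maxWeight E r = maxWeight E' r := by
  unfold maxWeight
  rw [incSubsets_eq_of_nonTop_eq h r]
  refine Finset.sup_congr rfl fun T hT => ?_
  exact weightOf_eq_of_nonTop_eq h (top_notMem_of_hasCommonPoint (mem_incSubsets_iff.mp hT).2.2)

/-- Same `n_r`. [folklore] -/
theorem numMax_eq_of_nonTop_eq {E E' : List (X.IdealSheafData × ℕ)} (h : nonTop E = nonTop E') (r : ℕ) :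
    numMax E r = numMax E' r := by
  classical
  unfold numMax
  rw [incSubsets_eq_of_nonTop_eq h r, maxWeight_eq_of_nonTop_eq h r]
  congr 1
  refine Finset.filter_congr fun T hT => ?_
  rw [weightOf_eq_of_nonTop_eq h (top_notMem_of_hasCommonPoint (mem_incSubsets_iff.mp hT).2.2)]

/-- Same qualifying sets. [folklore] -/
theorem qualifying_eq_of_nonTop_eq {E E' : List (X.IdealSheafData × ℕ)} (h : nonTop E = nonTop E')
    (m r : ℕ) : qualifying E m r = qualifying E' m r := by
  ext T
  rw [mem_qualifying_iff, mem_qualifying_iff, incSubsets_eq_of_nonTop_eq h r]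
  constructor
  · rintro ⟨hT, hmT⟩
    exact ⟨hT, by rwa [← weightOf_eq_of_nonTop_eq h (top_notMem_of_hasCommonPoint (mem_incSubsets_iff.mp hT).2.2)]⟩
  · rintro ⟨hT, hmT⟩
    exact ⟨hT, by rwa [weightOf_eq_of_nonTop_eq h (top_notMem_of_hasCommonPoint (mem_incSubsets_iff.mp hT).2.2)]⟩

/-- Same `HasPhase`. [folklore] -/
theorem hasPhase_iff_of_nonTop_eq {E E' : List (X.IdealSheafData × ℕ)} (h : nonTop E = nonTop E') (m : ℕ) :
    HasPhase E m ↔ HasPhase E' m := by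
  unfold HasPhase
  simp only [qualifying_eq_of_nonTop_eq h]

/-- Same phase. [folklore] -/
theorem phase_eq_of_nonTop_eq {E E' : List (X.IdealSheafData × ℕ)} (h : nonTop E = nonTop E') (m : ℕ) :
    phase E m = phase E' m := by
  by_cases hp : HasPhase E m
  · have hp' : HasPhase E' m := (hasPhase_iff_of_nonTop_eq h m).mp hp
    refine le_antisymm (phase_le_of_qualifying_nonempty ?_) (phase_le_of_qualifying_nonempty ?_)
    · rw [qualifying_eq_of_nonTop_eq h]
      exact qualifying_phase_nonempty hp'
    · rw [← qualifying_eq_of_nonTop_eq h]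
      exact qualifying_phase_nonempty hp
  · have hp' : ¬ HasPhase E' m := fun h' => hp ((hasPhase_iff_of_nonTop_eq h m).mpr h')
    classical
    simp only [phase, dif_neg hp, dif_neg hp']

/-- Same candidates. [folklore] -/
theorem candidates_eq_of_nonTop_eq {E E' : List (X.IdealSheafData × ℕ)} (h : nonTop E = nonTop E') (m : ℕ) :
    candidates E m = candidates E' m := by
  ext T
  rw [mem_candidates_iff, mem_candidates_iff, ← phase_eq_of_nonTop_eq h, ← incSubsets_eq_of_nonTop_eq h,
    ← maxWeight_eq_of_nonTop_eq h]
  constructor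
  · rintro ⟨hT, hmT, hw⟩
    rw [weightOf_eq_of_nonTop_eq h (top_notMem_of_hasCommonPoint (mem_incSubsets_iff.mp hT).2.2)] at hmT hw
    exact ⟨hT, hmT, hw⟩
  · rintro ⟨hT, hmT, hw⟩
    rw [← weightOf_eq_of_nonTop_eq h (top_notMem_of_hasCommonPoint (mem_incSubsets_iff.mp hT).2.2)] at hmT hw
    exact ⟨hT, hmT, hw⟩

/-- **The relative order of first occurrences of non-empty divisors only depends on the
non-empty entries.** [folklore] -/
theorem posOf_lt_posOf_iff_of_nonTop_eq {E E' : List (X.IdealSheafData × ℕ)} (h : nonTop E = nonTop E')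
    {K₁ K₂ : X.IdealSheafData} (h₁ : K₁ ∈ boundaryOf E) (h₂ : K₂ ∈ boundaryOf E) (hK₁ : K₁ ≠ ⊤)
    (hK₂ : K₂ ≠ ⊤) : posOf E K₁ < posOf E K₂ ↔ posOf E' K₁ < posOf E' K₂ := by
  classical
  have h₁' : K₁ ∈ boundaryOf E' := (mem_boundaryOf_iff_of_nonTop_eq h hK₁).mp h₁
  have h₂' : K₂ ∈ boundaryOf E' := (mem_boundaryOf_iff_of_nonTop_eq h hK₂).mp h₂
  have hq₁ : (fun K : X.IdealSheafData => decide (K ≠ ⊤)) K₁ = true := decide_eq_true hK₁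
  have hq₂ : (fun K : X.IdealSheafData => decide (K ≠ ⊤)) K₂ = true := decide_eq_true hK₂
  have hb : (boundaryOf E).filter (fun K => decide (K ≠ ⊤)) = (boundaryOf E').filter (fun K => decide (K ≠ ⊤)) := by
    have hE := boundaryOf_nonTop E
    have hE' := boundaryOf_nonTop E'
    rw [h] at hE
    exact hE.symm.trans hE'
  unfold posOf
  rw [List.idxOf_lt_idxOf_iff_filter (fun K : X.IdealSheafData => decide (K ≠ ⊤)) (boundaryOf E) h₁ h₂ hq₁ hq₂,
    List.idxOf_lt_idxOf_iff_filter (fun K : X.IdealSheafData => decide (K ≠ ⊤)) (boundaryOf E') h₁' h₂' hq₁ hq₂, hb]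

/-- **Kollár's choice only depends on the non-empty entries.** [cite: Kollar2007, (3.111) Step 3 with 3.32] -/
theorem isCanonicalStratum_iff_of_nonTop_eq {E E' : List (X.IdealSheafData × ℕ)} (h : nonTop E = nonTop E')
    (m : ℕ) (T : Finset X.IdealSheafData) : IsCanonicalStratum E m T ↔ IsCanonicalStratum E' m T := by
  classical
  -- members of candidates are listed non-empty divisors, on both sides
  have hmemE : ∀ {F : List (X.IdealSheafData × ℕ)} {S : Finset X.IdealSheafData}, S ∈ candidates F m →
      ∀ K ∈ S, K ∈ boundaryOf F ∧ K ≠ ⊤ := by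
    intro F S hS K hK
    obtain ⟨hSinc, -, -⟩ := mem_candidates_iff.mp hS
    obtain ⟨hsub, -, hc⟩ := mem_incSubsets_iff.mp hSinc
    exact ⟨mem_sheaves_iff.mp (hsub hK), fun htop => top_notMem_of_hasCommonPoint hc (htop ▸ hK)⟩
  -- code comparisons agree on candidates
  have hcode : ∀ {S₁ S₂ : Finset X.IdealSheafData}, S₁ ∈ candidates E m → S₂ ∈ candidates E m →
      (lexCode E S₁ ≤ lexCode E S₂ ↔ lexCode E' S₁ ≤ lexCode E' S₂) := by
    intro S₁ S₂ hS₁ hS₂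
    have hmem : ∀ K ∈ S₁ ∪ S₂, K ∈ boundaryOf E ∧ K ≠ ⊤ := fun K hK => by
      rcases Finset.mem_union.mp hK with hK | hK
      · exact hmemE hS₁ K hK
      · exact hmemE hS₂ K hK
    have hmem' : ∀ K ∈ S₁ ∪ S₂, K ∈ boundaryOf E' := fun K hK =>
      (mem_boundaryOf_iff_of_nonTop_eq h (hmem K hK).2).mp (hmem K hK).1
    unfold lexCode
    exact toColex_image_toDual_le_iff_of_forall_lt_iff S₁ S₂ (posOf E) (posOf E')
      (fun a ha b hb hab => eq_of_posOf_eq (hmem a ha).1 (hmem b hb).1 hab)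
      (fun a ha b hb hab => eq_of_posOf_eq (hmem' a ha) (hmem' b hb) hab)
      (fun a ha b hb => posOf_lt_posOf_iff_of_nonTop_eq h (hmem a ha).1 (hmem b hb).1 (hmem a ha).2 (hmem b hb).2)
  unfold IsCanonicalStratum
  rw [← candidates_eq_of_nonTop_eq h]
  constructor
  · rintro ⟨hT, hmax⟩
    exact ⟨hT, fun T' hT' => (hcode hT' hT).mp (hmax T' hT')⟩
  · rintro ⟨hT, hmax⟩
    exact ⟨hT, fun T' hT' => (hcode hT' hT).mpr (hmax T' hT')⟩

/-- Same measure. [folklore] -/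
theorem measure_eq_of_nonTop_eq {E E' : List (X.IdealSheafData × ℕ)} (h : nonTop E = nonTop E') (m : ℕ)
    (hc : maxCard E = maxCard E') : measure E m = measure E' m := by
  by_cases hp : HasPhase E m
  · rw [measure_of_hasPhase hp, measure_of_hasPhase ((hasPhase_iff_of_nonTop_eq h m).mp hp), hc,
      phase_eq_of_nonTop_eq h, maxWeight_eq_of_nonTop_eq h, numMax_eq_of_nonTop_eq h]
  · rw [measure_of_not_hasPhase hp,
      measure_of_not_hasPhase fun h' => hp ((hasPhase_iff_of_nonTop_eq h m).mpr h')]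

/-- Same `maxCard`. [folklore] -/
theorem maxCard_eq_of_nonTop_eq {E E' : List (X.IdealSheafData × ℕ)} (h : nonTop E = nonTop E') :
    maxCard E = maxCard E' := by
  classical
  have key : ∀ {F F' : List (X.IdealSheafData × ℕ)}, nonTop F = nonTop F' → maxCard F ≤ maxCard F' := by
    intro F F' hFF'
    unfold maxCard
    refine Finset.sup_le fun T hT => ?_
    obtain ⟨hsub, hc⟩ := Finset.mem_filter.mp hT
    refine Finset.le_sup (f := Finset.card) (Finset.mem_filter.mpr ⟨Finset.mem_powerset.mpr fun K hK => ?_, hc⟩)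
    have hKt : K ≠ ⊤ := fun htop => top_notMem_of_hasCommonPoint hc (htop ▸ hK)
    exact mem_sheaves_iff.mpr ((mem_boundaryOf_iff_of_nonTop_eq hFF' hKt).mp
      (mem_sheaves_iff.mp (Finset.mem_powerset.mp hsub hK)))
  exact le_antisymm (key h) (key h.symm)

end NonTop

/-! ## The canonical sequence ignores empty members of the boundary -/

section NonTopSeq

variable {X : Scheme.{u}}

/-- An empty divisor passes through no point. [folklore] -/
theorem ne_top_of_mem_support {K : X.IdealSheafData} {x : X} (hx : x ∈ K.support) : K ≠ ⊤ := by
  intro htop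
  rw [htop, Scheme.IdealSheafData.support_top] at hx
  exact (hx : x ∈ (⊥ : Closeds X)).elim

/-- **Simple normal crossings only depend on the non-empty members** (the empty ones pass
through no point; `HasSNCWith.of_boundaryEquiv`). [folklore] -/
theorem HasSNC.of_nonTop_eq {E E' : List (X.IdealSheafData × ℕ)} (hE : HasSNC (boundaryOf E))
    (h : nonTop E = nonTop E') : HasSNC (boundaryOf E') := by
  classical
  have hinj : ∀ x, StalkInjectiveAt (boundaryOf E) x := fun x => hE.injOn_stalkIdeal x
  have hF : (boundaryOf E).filter (fun D => D ≠ ⊤) = (boundaryOf E').filter (fun D => D ≠ ⊤) := by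
    have h₁ := boundaryOf_nonTop E
    have h₂ := boundaryOf_nonTop E'
    rw [h] at h₁
    exact h₁.symm.trans h₂
  have hinj' : ∀ x, StalkInjectiveAt (boundaryOf E') x := by
    intro x D hD D' hD' hx hx' heq
    exact hinj x D ((mem_boundaryOf_iff_of_nonTop_eq h (ne_top_of_mem_support hx)).mpr hD) D'
      ((mem_boundaryOf_iff_of_nonTop_eq h (ne_top_of_mem_support hx')).mpr hD') hx hx' heq
  have e₁ : BoundaryEquiv (boundaryOf E) ((boundaryOf E).filter fun D => D ≠ ⊤) :=
    boundaryEquiv_filter_ne_top hinj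
  have e₂ : BoundaryEquiv (boundaryOf E') ((boundaryOf E').filter fun D => D ≠ ⊤) :=
    boundaryEquiv_filter_ne_top hinj'
  rw [hF] at e₁
  exact HasSNCWith.of_boundaryEquiv (e₁.trans e₂.symm) hE

/-- Transforming lists with the same non-empty entries along the same stratum gives lists with
the same non-empty entries (the strict transform of an empty divisor is empty). [folklore] -/
theorem nonTop_transformExp_eq {X' : Scheme.{u}} {E E' : List (X.IdealSheafData × ℕ)}
    (h : nonTop E = nonTop E') (π : X' ⟶ X) {T : Finset X.IdealSheafData} (hT : ⊤ ∉ T) (m : ℕ) :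
    nonTop (transformExp E π T m) = nonTop (transformExp E' π T m) := by
  classical
  have key : ∀ F : List (X.IdealSheafData × ℕ),
      nonTop (F.map fun p => (strictTransformIdeal π (T.sup id) p.1, p.2)) =
        ((nonTop F).filter fun p => strictTransformIdeal π (T.sup id) p.1 ≠ ⊤).map
          fun p => (strictTransformIdeal π (T.sup id) p.1, p.2) := by
    intro F
    simp only [nonTop, List.filter_map, List.filter_filter]
    congr 1
    apply List.filter_congr
    intro p _
    by_cases hp : p.1 = ⊤
    · simp [hp, strictTransformIdeal_top]
    · simp [hp]
  unfold transformExp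
  rw [nonTop_append, nonTop_append, key E, key E', h, weightOf_eq_of_nonTop_eq h hT]

/-- **The canonical sequence ignores the empty members of the ordered boundary** (Kollár 3.32,
Notation 3.64 (3): "each `E^i` is allowed to be reducible or empty"; the functors of Thm. 3.107
must not see the empty ones): exponent lists with the same non-`⊤` entries in the same order have
the same canonical sequence. [cite: Kollar2007, (3.111) Step 3 with 3.32 (p. 130)] -/
theorem monoSeq_eq_of_nonTop_eq [IsLocallyNoetherian X] {E E' : List (X.IdealSheafData × ℕ)}
    (hE : HasSNC (boundaryOf E)) {m : ℕ} (hm : 1 ≤ m) (h : nonTop E = nonTop E') :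
    monoSeq X E m = monoSeq X E' m := by
  suffices H : ∀ (l : ℕ ×ₗ ℕ ×ₗ ℕ) (X : Scheme.{u}) [IsLocallyNoetherian X]
      (E E' : List (X.IdealSheafData × ℕ)), measure E m = l → HasSNC (boundaryOf E) →
      nonTop E = nonTop E' → monoSeq X E m = monoSeq X E' m from H _ X E E' rfl hE h
  intro l
  induction l using (wellFounded_lt (α := ℕ ×ₗ ℕ ×ₗ ℕ)).induction with
  | _ l ih =>
  intro X _ E E' hl hE h
  have hE' : HasSNC (boundaryOf E') := hE.of_nonTop_eq h
  rcases monoSeq_cases (X := X) hE hm with ⟨hsupp, hnil⟩ | ⟨T, hT, hcons⟩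
  · have hp : ¬ HasPhase E m := fun hp => by
      have hne := (hasPhase_iff_support_nonempty hE).mp hp
      rw [hsupp] at hne
      exact Set.not_nonempty_empty hne
    rw [hnil, monoSeq_eq_nil_of_not_hasPhase fun hp' => hp ((hasPhase_iff_of_nonTop_eq h m).mpr hp')]
  · have hT' : IsCanonicalStratum E' m T := (isCanonicalStratum_iff_of_nonTop_eq h m T).mp hT
    rw [hcons, monoSeq_eq_cons hE' hm hT']
    haveI : IsLocallyNoetherian (blowup (T.sup id)) := CentreSeq.isLocallyNoetherian_blowup _
    rw [ih _ (hl ▸ measure_transformExp_lt hE (blowup.isBlowup _) hm hT) (blowup (T.sup id)) _ _ rfl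
      (hasSNC_boundaryOf_transformExp hE hT.mem_boundaryOf (blowup.isBlowup _) m)
      (nonTop_transformExp_eq h (blowup.π _) (top_notMem_of_hasCommonPoint hT.hasCommonPoint) m)]

/-- **The canonical sequence contains no empty blow-ups** (convention 3.32).
[cite: Kollar2007, 3.32 (p. 130)] -/
theorem noEmptyCentres_monoSeq [IsLocallyNoetherian X] {E : List (X.IdealSheafData × ℕ)}
    (hE : HasSNC (boundaryOf E)) {m : ℕ} (hm : 1 ≤ m) : (monoSeq X E m).NoEmptyCentres := by
  suffices H : ∀ (l : ℕ ×ₗ ℕ ×ₗ ℕ) (X : Scheme.{u}) [IsLocallyNoetherian X]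
      (E : List (X.IdealSheafData × ℕ)), measure E m = l → HasSNC (boundaryOf E) →
      (monoSeq X E m).NoEmptyCentres from H _ X E rfl hE
  intro l
  induction l using (wellFounded_lt (α := ℕ ×ₗ ℕ ×ₗ ℕ)).induction with
  | _ l ih =>
  intro X _ E hl hE
  rcases monoSeq_cases (X := X) hE hm with ⟨-, hnil⟩ | ⟨T, hT, hcons⟩
  · rw [hnil]
    trivial
  · rw [hcons]
    haveI : IsLocallyNoetherian (blowup (T.sup id)) := CentreSeq.isLocallyNoetherian_blowup _
    exact ⟨hT.sup_ne_top, ih _ (hl ▸ measure_transformExp_lt hE (blowup.isBlowup _) hm hT)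
      (blowup (T.sup id)) _ rfl (hasSNC_boundaryOf_transformExp hE hT.mem_boundaryOf (blowup.isBlowup _) m)⟩

end NonTopSeq

/-! ## Sets of divisors with a common point along a flat morphism -/

section Pullback

open scoped Classical

variable {X X' : Scheme.{u}} (f : X' ⟶ X)

/-- The divisors of the pulled-back list. [folklore] -/
theorem sheaves_comapExp {E : List (X.IdealSheafData × ℕ)} :
    sheaves (comapExp E f) = (sheaves E).image fun K => K.comap f := by
  ext K'
  simp only [mem_sheaves_iff, Finset.mem_image, mem_boundaryOf_comapExp_iff]

/-- A common point upstairs lies over a common point downstairs. [folklore] -/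
theorem hasCommonPoint_of_image {T : Finset X.IdealSheafData}
    (hc : HasCommonPoint (T.image fun K => K.comap f)) : HasCommonPoint T := by
  obtain ⟨x', hx'⟩ := hc
  refine ⟨f x', fun K hK => ?_⟩
  have h : x' ∈ ((K.comap f).support : Set X') := hx' _ (Finset.mem_image_of_mem _ hK)
  rwa [Scheme.IdealSheafData.support_comap] at h

/-- Along a surjection a common point downstairs lifts to a common point upstairs. [folklore] -/
theorem hasCommonPoint_image_of_surjective [Surjective f] {T : Finset X.IdealSheafData}
    (hc : HasCommonPoint T) : HasCommonPoint (T.image fun K => K.comap f) := by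
  obtain ⟨x, hx⟩ := hc
  obtain ⟨x', rfl⟩ := f.surjective x
  refine ⟨x', fun K' hK' => ?_⟩
  obtain ⟨K, hK, rfl⟩ := Finset.mem_image.mp hK'
  show x' ∈ ((K.comap f).support : Set X')
  rw [Scheme.IdealSheafData.support_comap]
  exact hx K hK

/-- **A set of divisors upstairs is the pull-back of a set of divisors downstairs.** [folklore] -/
theorem exists_eq_image_of_subset_sheaves {E : List (X.IdealSheafData × ℕ)} {T' : Finset X'.IdealSheafData}
    (hT' : T' ⊆ sheaves (comapExp E f)) :
    ∃ T : Finset X.IdealSheafData, T ⊆ sheaves E ∧ (T.image fun K => K.comap f) = T' := by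
  refine ⟨(sheaves E).filter fun K => K.comap f ∈ T', Finset.filter_subset _ _, ?_⟩
  ext K'
  simp only [Finset.mem_image, Finset.mem_filter]
  constructor
  · rintro ⟨K, ⟨-, hK⟩, rfl⟩
    exact hK
  · intro hK'
    have hmem := hT' hK'
    rw [sheaves_comapExp, Finset.mem_image] at hmem
    obtain ⟨K, hK, rfl⟩ := hmem
    exact ⟨K, ⟨hK, hK'⟩, rfl⟩

variable [Flat f]

/-- Along a flat morphism, distinct members of an snc boundary have distinct pull-backs
wherever these are visible (the stalk upstairs determines the stalk downstairs by faithful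
flatness; an snc boundary is stalkwise injective). [cite: Matsumura1987, Thm. 7.5] -/
theorem eq_of_comap_eq_of_mem_support {B : List X.IdealSheafData} (hB : HasSNC B)
    {K₁ K₂ : X.IdealSheafData} (h₁ : K₁ ∈ B) (h₂ : K₂ ∈ B) {x' : X'}
    (hx : x' ∈ (K₁.comap f).support) (heq : K₁.comap f = K₂.comap f) : K₁ = K₂ := by
  have hx₁ : f x' ∈ K₁.support := by
    have h : x' ∈ ((K₁.comap f).support : Set X') := hx
    rwa [Scheme.IdealSheafData.support_comap] at h
  have hx₂ : f x' ∈ K₂.support := by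
    have h : x' ∈ ((K₂.comap f).support : Set X') := heq ▸ hx
    rwa [Scheme.IdealSheafData.support_comap] at h
  exact hB.injOn_stalkIdeal (f x') K₁ h₁ K₂ h₂ hx₁ hx₂
    (stalkIdeal_eq_of_stalkIdeal_comap_eq f (by rw [heq]))

variable {E : List (X.IdealSheafData × ℕ)} (hE : HasSNC (boundaryOf E))
include hE

/-- **Pulling back is injective on a set of boundary divisors whose pull-backs have a common
point.** [folklore] -/
theorem injOn_comap_of_hasCommonPoint {T : Finset X.IdealSheafData} (hT : T ⊆ sheaves E)
    (hc : HasCommonPoint (T.image fun K => K.comap f)) :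
    Set.InjOn (fun K => K.comap f) (T : Set X.IdealSheafData) := by
  classical
  obtain ⟨x', hx'⟩ := hc
  intro K₁ hK₁ K₂ hK₂ heq
  exact eq_of_comap_eq_of_mem_support f hE (mem_sheaves_iff.mp (hT (Finset.mem_coe.mp hK₁)))
    (mem_sheaves_iff.mp (hT (Finset.mem_coe.mp hK₂))) (hx' _ (Finset.mem_image_of_mem _ (Finset.mem_coe.mp hK₁))) heq

/-- Hence such a set and its pull-back have the same number of members. [folklore] -/
theorem card_image_comap {T : Finset X.IdealSheafData} (hT : T ⊆ sheaves E)
    (hc : HasCommonPoint (T.image fun K => K.comap f)) : (T.image fun K => K.comap f).card = T.card := by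
  classical
  exact Finset.card_image_of_injOn (injOn_comap_of_hasCommonPoint f hE hT hc)

/-- **The old divisors behind a pulled-back set with a common point are the set itself.** [folklore] -/
theorem filter_comap_mem_image_eq {T : Finset X.IdealSheafData} (hT : T ⊆ sheaves E)
    (hc : HasCommonPoint (T.image fun K => K.comap f)) :
    ((sheaves E).filter fun K => K.comap f ∈ T.image fun K => K.comap f) = T := by
  obtain ⟨x', hx'⟩ := hc
  ext K
  simp only [Finset.mem_filter, Finset.mem_image]
  constructor
  · rintro ⟨hK, K₀, hK₀, heq⟩
    have hx₀ : x' ∈ (K₀.comap f).support := hx' _ (Finset.mem_image_of_mem _ hK₀)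
    rwa [← eq_of_comap_eq_of_mem_support f hE (mem_sheaves_iff.mp (hT hK₀)) (mem_sheaves_iff.mp hK) hx₀ heq]
  · intro hK
    exact ⟨hT hK, K, hK, rfl⟩

/-- **The weight of a pulled-back set with a common point is the weight of the set.** [folklore] -/
theorem weightOf_comapExp_image {T : Finset X.IdealSheafData} (hT : T ⊆ sheaves E)
    (hc : HasCommonPoint (T.image fun K => K.comap f)) :
    weightOf (comapExp E f) (T.image fun K => K.comap f) = weightOf E T := by
  classical
  have h := weightOf_map (E := E) (fun K => K.comap f) (T.image fun K => K.comap f)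
  rw [filter_comap_mem_image_eq f hE hT hc] at h
  exact h

/-- Pull-backs of `r`-sets with a common point upstairs are `r`-sets upstairs. [folklore] -/
theorem image_mem_incSubsets {r : ℕ} {T : Finset X.IdealSheafData} (hT : T ∈ incSubsets E r)
    (hc : HasCommonPoint (T.image fun K => K.comap f)) :
    (T.image fun K => K.comap f) ∈ incSubsets (comapExp E f) r := by
  classical
  obtain ⟨hsub, hcard, -⟩ := mem_incSubsets_iff.mp hT
  refine mem_incSubsets_iff.mpr ⟨?_, (card_image_comap f hE hsub hc).trans hcard, hc⟩
  rw [sheaves_comapExp]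
  exact Finset.image_subset_image hsub

/-- **Every `r`-set upstairs is the pull-back of an `r`-set downstairs of the same weight.** [folklore] -/
theorem exists_of_mem_incSubsets_comapExp {r : ℕ} {T' : Finset X'.IdealSheafData}
    (hT' : T' ∈ incSubsets (comapExp E f) r) :
    ∃ T ∈ incSubsets E r, (T.image fun K => K.comap f) = T' ∧
      weightOf (comapExp E f) T' = weightOf E T := by
  obtain ⟨hsub', hcard', hc'⟩ := mem_incSubsets_iff.mp hT'
  obtain ⟨T, hT, rfl⟩ := exists_eq_image_of_subset_sheaves f hsub'
  exact ⟨T, mem_incSubsets_iff.mpr ⟨hT, (card_image_comap f hE hT hc').symm.trans hcard',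
    hasCommonPoint_of_image f hc'⟩, rfl, weightOf_comapExp_image f hE hT hc'⟩

/-- **Positions are preserved**: the first occurrence of `f^*K` in the pulled-back list is the
first occurrence of `K`, for a divisor `K` visible upstairs. [folklore] -/
theorem posOf_comapExp {K : X.IdealSheafData} (hK : K ∈ boundaryOf E) {x' : X'}
    (hx : x' ∈ (K.comap f).support) : posOf (comapExp E f) (K.comap f) = posOf E K := by
  classical
  unfold posOf
  rw [boundaryOf_comapExp]
  refine List.idxOf_map_of_forall_eq (fun K => K.comap f) (boundaryOf E) fun K₀ hK₀ heq => ?_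
  exact eq_of_comap_eq_of_mem_support f hE hK₀ hK (heq ▸ hx) heq

/-- **Codes are preserved** for sets whose pull-backs have a common point. [folklore] -/
theorem lexCode_comapExp_image {T : Finset X.IdealSheafData} (hT : T ⊆ sheaves E)
    (hc : HasCommonPoint (T.image fun K => K.comap f)) :
    lexCode (comapExp E f) (T.image fun K => K.comap f) = lexCode E T := by
  classical
  obtain ⟨x', hx'⟩ := hc
  unfold lexCode
  rw [Finset.image_image]
  congr 1
  refine Finset.image_congr fun K hK => ?_
  simp only [Function.comp_apply]
  rw [posOf_comapExp f hE (mem_sheaves_iff.mp (hT (Finset.mem_coe.mp hK)))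
    (hx' _ (Finset.mem_image_of_mem _ (Finset.mem_coe.mp hK)))]

/-- **Kollár's choice commutes with pull-back where the chosen centre is visible**: if the
canonical stratum downstairs pulls back to a set with a common point, that set is the canonical
stratum of the pulled-back list. [cite: Kollar2007, (3.111) Step 3 with 3.34.1] -/
theorem IsCanonicalStratum.image_comap {m : ℕ} {T : Finset X.IdealSheafData}
    (hT : IsCanonicalStratum E m T) (hc : HasCommonPoint (T.image fun K => K.comap f)) :
    IsCanonicalStratum (comapExp E f) m (T.image fun K => K.comap f) := by
  classical
  set E' := comapExp E f with hE'def
  set r := phase E m with hr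
  have hTr : T ∈ incSubsets E r := hT.mem_incSubsets
  have hsub : T ⊆ sheaves E := (mem_incSubsets_iff.mp hTr).1
  have hTr' : (T.image fun K => K.comap f) ∈ incSubsets E' r := image_mem_incSubsets f hE hTr hc
  have hw : weightOf E' (T.image fun K => K.comap f) = weightOf E T := weightOf_comapExp_image f hE hsub hc
  -- qualifying sets upstairs come from qualifying sets downstairs
  have hqual : ∀ {s : ℕ} {T' : Finset X'.IdealSheafData}, T' ∈ qualifying E' m s → (qualifying E m s).Nonempty := by
    intro s T' hT'
    obtain ⟨hT'inc, hmT'⟩ := mem_qualifying_iff.mp hT'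
    obtain ⟨T₀, hT₀, -, hw₀⟩ := exists_of_mem_incSubsets_comapExp f hE hT'inc
    exact ⟨T₀, mem_qualifying_iff.mpr ⟨hT₀, hw₀ ▸ hmT'⟩⟩
  -- the phases agree
  have hTq' : (T.image fun K => K.comap f) ∈ qualifying E' m r :=
    mem_qualifying_iff.mpr ⟨hTr', hw.symm ▸ hT.le_weightOf⟩
  have hp' : HasPhase E' m := ⟨r, _, hTq'⟩
  have hphase : phase E' m = r := by
    refine le_antisymm (phase_le_of_qualifying_nonempty ⟨_, hTq'⟩) ?_
    obtain ⟨T', hT'⟩ := qualifying_phase_nonempty hp'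
    exact phase_le_of_qualifying_nonempty (hqual hT')
  -- the maximal weights agree
  have hmax : maxWeight E' r = maxWeight E r := by
    refine le_antisymm (Finset.sup_le fun T' hT' => ?_) ?_
    · obtain ⟨T₀, hT₀, -, hw₀⟩ := exists_of_mem_incSubsets_comapExp f hE hT'
      rw [hw₀]
      exact weightOf_le_maxWeight hT₀
    · rw [← hT.weightOf_eq, ← hw]
      exact weightOf_le_maxWeight hTr'
  refine ⟨mem_candidates_iff.mpr ⟨hphase.symm ▸ hTr', hw.symm ▸ hT.le_weightOf, ?_⟩, fun T' hT' => ?_⟩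
  · rw [hphase, hmax, hw, hT.weightOf_eq]
  · -- a candidate upstairs comes from a candidate downstairs, with the same code
    obtain ⟨hT'inc, hmT', hwT'⟩ := mem_candidates_iff.mp hT'
    rw [hphase] at hT'inc hwT'
    obtain ⟨hsub', -, hc'⟩ := mem_incSubsets_iff.mp hT'inc
    obtain ⟨T₀, hT₀, hT₀eq, hw₀⟩ := exists_of_mem_incSubsets_comapExp f hE hT'inc
    have hsub₀ : T₀ ⊆ sheaves E := (mem_incSubsets_iff.mp hT₀).1
    have hc₀ : HasCommonPoint (T₀.image fun K => K.comap f) := hT₀eq.symm ▸ hc'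
    have hcand₀ : T₀ ∈ candidates E m := mem_candidates_iff.mpr
      ⟨hT₀, hw₀ ▸ hmT', by rw [← hw₀, hwT', hmax]⟩
    rw [← hT₀eq, lexCode_comapExp_image f hE hsub₀ hc₀, lexCode_comapExp_image f hE hsub hc]
    exact hT.2 T₀ hcand₀

end Pullback

/-! ## Transforming and pulling back commute -/

section Square

open scoped Classical

variable {X X' : Scheme.{u}} (f : X' ⟶ X)

/-- Inverse images commute with finite sums of ideal sheaves: `f^*(∑_{K∈T} K) = ∑_{K∈T} f^*K`.
[folklore] -/
theorem comap_finsetSup_eq_image_sup (T : Finset X.IdealSheafData) :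
    (T.sup id).comap f = (T.image fun K => K.comap f).sup id := by
  induction T using Finset.induction_on with
  | empty =>
    rw [Finset.sup_empty, Finset.image_empty, Finset.sup_empty]
    exact (Scheme.IdealSheafData.map_gc f).l_bot
  | insert K T hK ih =>
    rw [Finset.sup_insert, Finset.image_insert, Finset.sup_insert, id, id,
      (Scheme.IdealSheafData.map_gc f).l_sup, ih]

variable [Flat f] [IsLocallyNoetherian X] [IsLocallyNoetherian X']

/-- **Transforming and pulling back commute**, given that the pulled-back stratum has the weight
of the stratum (strict transforms and the exceptional divisor commute with the flat base change
`Bl_{f^*C}(X') → Bl_C(X)`). [cite: Kollar2007, (3.111) Step 3 with 3.34.1] -/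
theorem comapExp_transformExp (E : List (X.IdealSheafData × ℕ)) (T : Finset X.IdealSheafData)
    (m : ℕ) (C : X.IdealSheafData)
    (hw : weightOf (comapExp E f) (T.image fun K => K.comap f) = weightOf E T) :
    comapExp (transformExp E (blowup.π C) T m) (blowup.comapMap C f) =
      transformExp (comapExp E f) (blowup.π (C.comap f)) (T.image fun K => K.comap f) m := by
  haveI : IsLocallyNoetherian (blowup C) := CentreSeq.isLocallyNoetherian_blowup C
  haveI : IsLocallyNoetherian (blowup (C.comap f)) := CentreSeq.isLocallyNoetherian_blowup _
  haveI : Flat (blowup.comapMap C f) := blowup.comapMap_mem @Flat C f ‹_›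
  have hsq := blowup.comapMap_π C f
  unfold transformExp
  rw [hw, comapExp_append]
  simp only [comapExp, List.map_map, List.map_cons, List.map_nil]
  rw [← comap_finsetSup_eq_image_sup, ← Scheme.IdealSheafData.comap_comp, hsq,
    Scheme.IdealSheafData.comap_comp]
  congr 1
  refine List.map_congr_left fun p _ => ?_
  simp only [Function.comp_apply, Prod.mk.injEq, and_true]
  exact comap_strictTransformIdeal_of_flat f hsq (T.sup id) p.1

/-- **The boundary of the pulled-back transformed list is the boundary of the transformed
pulled-back list** (no hypothesis on weights: boundaries ignore exponents). [folklore] -/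
theorem boundaryOf_comapExp_transformExp (E : List (X.IdealSheafData × ℕ)) (T : Finset X.IdealSheafData)
    (m : ℕ) (C : X.IdealSheafData) :
    boundaryOf (comapExp (transformExp E (blowup.π C) T m) (blowup.comapMap C f)) =
      boundaryOf (transformExp (comapExp E f) (blowup.π (C.comap f)) (T.image fun K => K.comap f) m) := by
  haveI : IsLocallyNoetherian (blowup C) := CentreSeq.isLocallyNoetherian_blowup C
  haveI : IsLocallyNoetherian (blowup (C.comap f)) := CentreSeq.isLocallyNoetherian_blowup _
  haveI : Flat (blowup.comapMap C f) := blowup.comapMap_mem @Flat C f ‹_›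
  have hsq := blowup.comapMap_π C f
  simp only [transformExp, comapExp, boundaryOf, List.map_append, List.map_map, List.map_cons, List.map_nil]
  rw [← comap_finsetSup_eq_image_sup, ← Scheme.IdealSheafData.comap_comp, hsq,
    Scheme.IdealSheafData.comap_comp]
  congr 1
  refine List.map_congr_left fun p _ => ?_
  simp only [Function.comp_apply]
  exact comap_strictTransformIdeal_of_flat f hsq (T.sup id) p.1

/-- **When the stratum is invisible upstairs**, the pulled-back transformed list is the list
pulled back along `Bl_{f^*C}(X') → X'` followed by one EMPTY divisor.
[cite: Kollar2007, (3.111) Step 3 with 3.34.1] -/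
theorem comapExp_transformExp_of_comap_eq_top (E : List (X.IdealSheafData × ℕ)) (T : Finset X.IdealSheafData)
    (m : ℕ) (C : X.IdealSheafData) (htop : (T.sup id).comap f = ⊤) :
    comapExp (transformExp E (blowup.π C) T m) (blowup.comapMap C f) =
      comapExp (comapExp E f) (blowup.π (C.comap f)) ++ [(⊤, weightOf E T - m)] := by
  haveI : IsLocallyNoetherian (blowup C) := CentreSeq.isLocallyNoetherian_blowup C
  haveI : IsLocallyNoetherian (blowup (C.comap f)) := CentreSeq.isLocallyNoetherian_blowup _
  haveI : Flat (blowup.comapMap C f) := blowup.comapMap_mem @Flat C f ‹_›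
  have hsq := blowup.comapMap_π C f
  simp only [transformExp, comapExp, List.map_append, List.map_map, List.map_cons, List.map_nil]
  rw [← Scheme.IdealSheafData.comap_comp, hsq, Scheme.IdealSheafData.comap_comp, htop,
    Scheme.IdealSheafData.comap_top]
  congr 1
  refine List.map_congr_left fun p _ => ?_
  simp only [Function.comp_apply, Prod.mk.injEq, and_true]
  rw [comap_strictTransformIdeal_of_flat f hsq (T.sup id) p.1, htop, strictTransformIdeal_of_eq_top _ rfl]

end Square

/-! ## The canonical sequence along flat morphisms -/

section Functoriality

open scoped Classical

variable {X : Scheme.{u}}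

/-- Unfolding the canonical sequence with the centre named. [folklore] -/
theorem monoSeq_eq_cons' [IsLocallyNoetherian X] {E : List (X.IdealSheafData × ℕ)} (hE : HasSNC (boundaryOf E))
    {m : ℕ} (hm : 1 ≤ m) {T : Finset X.IdealSheafData} (hT : IsCanonicalStratum E m T)
    {C : X.IdealSheafData} (hC : T.sup id = C) :
    monoSeq X E m = CentreSeq.cons C (monoSeq (blowup C) (transformExp E (blowup.π C) T m) m) := by
  subst hC
  exact monoSeq_eq_cons hE hm hT

/-- **For `f` flat and surjective, the canonical sequence commutes with pull-back exactly:
`(monoSeq X E m).comap f = monoSeq X' (f^*E) m`** (Kollár 3.34.1, first bullet — smooth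
surjections —, and 3.34.2 — changes of fields —, for Step 3 of 3.111).
[cite: Kollar2007, (3.111) Step 3 with 3.34.1–3.34.2 (p. 131)] -/
theorem monoSeq_comap_of_surjective {X' : Scheme.{u}} (f : X' ⟶ X) [Flat f] [Surjective f]
    [IsLocallyNoetherian X] [IsLocallyNoetherian X'] {E : List (X.IdealSheafData × ℕ)}
    (hE : HasSNC (boundaryOf E)) (hE' : HasSNC (boundaryOf (comapExp E f))) {m : ℕ} (hm : 1 ≤ m) :
    (monoSeq X E m).comap f = monoSeq X' (comapExp E f) m := by
  suffices H : ∀ (l : ℕ ×ₗ ℕ ×ₗ ℕ) (X X' : Scheme.{u}) (f : X' ⟶ X) [Flat f] [Surjective f]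
      [IsLocallyNoetherian X] [IsLocallyNoetherian X'] (E : List (X.IdealSheafData × ℕ)),
      measure E m = l → HasSNC (boundaryOf E) → HasSNC (boundaryOf (comapExp E f)) →
      (monoSeq X E m).comap f = monoSeq X' (comapExp E f) m from H _ X X' f E rfl hE hE'
  intro l
  induction l using (wellFounded_lt (α := ℕ ×ₗ ℕ ×ₗ ℕ)).induction with
  | _ l ih =>
  intro X X' f _ _ _ _ E hl hE hE'
  classical
  rcases monoSeq_cases (X := X) hE hm with ⟨hsupp, hnil⟩ | ⟨T, hT, hcons⟩
  · -- empty support on both sides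
    have hsupp' : (monomialMarked (comapExp E f) m).support = ∅ := by
      ext x'
      simp only [Set.mem_empty_iff_false, iff_false]
      rw [mem_support_monomialMarked_comapExp_iff hE hE', hsupp]
      exact Set.notMem_empty _
    rw [hnil, monoSeq_eq_nil hE' hsupp', CentreSeq.comap_nil]
  · set C : X.IdealSheafData := T.sup id with hC
    have hc : HasCommonPoint (T.image fun K => K.comap f) := hasCommonPoint_image_of_surjective f hT.hasCommonPoint
    have hT' : IsCanonicalStratum (comapExp E f) m (T.image fun K => K.comap f) := hT.image_comap f hE hc
    have hsub : T ⊆ sheaves E := (mem_incSubsets_iff.mp hT.mem_incSubsets).1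
    have hw := weightOf_comapExp_image f hE hsub hc
    have hC' : (T.image fun K => K.comap f).sup id = C.comap f := (comap_finsetSup_eq_image_sup f T).symm
    rw [hcons, CentreSeq.comap_cons, monoSeq_eq_cons' hE' hm hT' hC']
    haveI : IsLocallyNoetherian (blowup C) := CentreSeq.isLocallyNoetherian_blowup C
    haveI : IsLocallyNoetherian (blowup (C.comap f)) := CentreSeq.isLocallyNoetherian_blowup _
    haveI : Flat (blowup.comapMap C f) := blowup.comapMap_mem @Flat C f ‹_›
    haveI : Surjective (blowup.comapMap C f) := blowup.comapMap_mem @Surjective C f ‹_›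
    have hlist := comapExp_transformExp f E T m C hw
    have hsnc₁ : HasSNC (boundaryOf (transformExp E (blowup.π C) T m)) :=
      hasSNC_boundaryOf_transformExp hE hT.mem_boundaryOf (blowup.isBlowup _) m
    have hsnc₁' : HasSNC (boundaryOf (comapExp (transformExp E (blowup.π C) T m) (blowup.comapMap C f))) := by
      rw [hlist]
      exact hasSNC_boundaryOf_transformExp hE' hT'.mem_boundaryOf (hC' ▸ blowup.isBlowup _) m
    rw [ih _ (hl ▸ measure_transformExp_lt hE (blowup.isBlowup _) hm hT) (blowup C) (blowup (C.comap f))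
      (blowup.comapMap C f) _ rfl hsnc₁ hsnc₁', hlist]

/-- **For `f` flat, the pull-back of the canonical sequence is an extension of the canonical
sequence of the pulled-back data** (Kollár 3.34.1, second bullet, in the form of BGMW Thm. 8.0.5
(2) / Def. 3.1.5: the two differ by trivial steps — the empty blow-ups Kollár deletes).
[cite: Kollar2007, (3.111) Step 3 with 3.34.1 (p. 131)]
[cite: BierstoneGrigorievMilmanWlodarczyk2011, Def. 3.1.5, Thm. 8.0.5 (2)] -/
theorem comap_monoSeq_isExtensionOf {X' : Scheme.{u}} (f : X' ⟶ X) [Flat f]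
    [IsLocallyNoetherian X] [IsLocallyNoetherian X'] {E : List (X.IdealSheafData × ℕ)}
    (hE : HasSNC (boundaryOf E)) (hE' : HasSNC (boundaryOf (comapExp E f))) {m : ℕ} (hm : 1 ≤ m) :
    ((monoSeq X E m).comap f).IsExtensionOf (monoSeq X' (comapExp E f) m) := by
  suffices H : ∀ (l : ℕ ×ₗ ℕ ×ₗ ℕ) (X X' : Scheme.{u}) (f : X' ⟶ X) [Flat f]
      [IsLocallyNoetherian X] [IsLocallyNoetherian X'] (E : List (X.IdealSheafData × ℕ)),
      measure E m = l → HasSNC (boundaryOf E) → HasSNC (boundaryOf (comapExp E f)) →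
      ((monoSeq X E m).comap f).IsExtensionOf (monoSeq X' (comapExp E f) m) from H _ X X' f E rfl hE hE'
  intro l
  induction l using (wellFounded_lt (α := ℕ ×ₗ ℕ ×ₗ ℕ)).induction with
  | _ l ih =>
  intro X X' f _ _ _ E hl hE hE'
  classical
  rcases monoSeq_cases (X := X) hE hm with ⟨hsupp, hnil⟩ | ⟨T, hT, hcons⟩
  · have hsupp' : (monomialMarked (comapExp E f) m).support = ∅ := by
      ext x'
      simp only [Set.mem_empty_iff_false, iff_false]
      rw [mem_support_monomialMarked_comapExp_iff hE hE', hsupp]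
      exact Set.notMem_empty _
    rw [hnil, monoSeq_eq_nil hE' hsupp', CentreSeq.comap_nil]
    exact rfl
  · set C : X.IdealSheafData := T.sup id with hC
    have hsub : T ⊆ sheaves E := (mem_incSubsets_iff.mp hT.mem_incSubsets).1
    have hC' : (T.image fun K => K.comap f).sup id = C.comap f := (comap_finsetSup_eq_image_sup f T).symm
    haveI : IsLocallyNoetherian (blowup C) := CentreSeq.isLocallyNoetherian_blowup C
    haveI : IsLocallyNoetherian (blowup (C.comap f)) := CentreSeq.isLocallyNoetherian_blowup _
    haveI : Flat (blowup.comapMap C f) := blowup.comapMap_mem @Flat C f ‹_›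
    have hlt : measure (transformExp E (blowup.π C) T m) m < l := hl ▸ measure_transformExp_lt hE (blowup.isBlowup _) hm hT
    have hsnc₁ : HasSNC (boundaryOf (transformExp E (blowup.π C) T m)) :=
      hasSNC_boundaryOf_transformExp hE hT.mem_boundaryOf (blowup.isBlowup _) m
    have hsnc₁' : HasSNC (boundaryOf (comapExp (transformExp E (blowup.π C) T m) (blowup.comapMap C f))) := by
      rw [boundaryOf_comapExp_transformExp]
      refine hasSNC_boundaryOf_transformExp hE' (fun K' hK' => ?_) (hC' ▸ blowup.isBlowup _) m
      obtain ⟨K, hK, rfl⟩ := Finset.mem_image.mp hK'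
      exact mem_boundaryOf_comapExp_iff.mpr ⟨K, hT.mem_boundaryOf K hK, rfl⟩
    have ih₁ := ih _ hlt (blowup C) (blowup (C.comap f)) (blowup.comapMap C f) _ rfl hsnc₁ hsnc₁'
    rw [hcons, CentreSeq.comap_cons]
    by_cases hc : HasCommonPoint (T.image fun K => K.comap f)
    · -- the centre is visible upstairs: it is the canonical centre there
      have hT' : IsCanonicalStratum (comapExp E f) m (T.image fun K => K.comap f) := hT.image_comap f hE hc
      have hw := weightOf_comapExp_image f hE hsub hc
      rw [monoSeq_eq_cons' hE' hm hT' hC', ← comapExp_transformExp f E T m C hw]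
      exact CentreSeq.IsExtensionOf.cons_cons ih₁
    · -- the centre is empty upstairs: a trivial step
      have htop : C.comap f = ⊤ := by
        rw [← Scheme.IdealSheafData.support_eq_bot_iff]
        ext x'
        simp only [Closeds.coe_bot, Set.mem_empty_iff_false, iff_false]
        intro hx'
        apply hc
        refine ⟨x', fun K' hK' => ?_⟩
        obtain ⟨K, hK, rfl⟩ := Finset.mem_image.mp hK'
        have h : x' ∈ ((C.comap f).support : Set X') := hx'
        rw [Scheme.IdealSheafData.support_comap] at h
        show x' ∈ ((K.comap f).support : Set X')
        rw [Scheme.IdealSheafData.support_comap]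
        exact (mem_support_finsetSup_iff T (f x')).mp h K hK
      refine (CentreSeq.cons_isExtensionOf_iff _ _ _).mpr (Or.inr ⟨htop, ?_⟩)
      haveI : IsIso (blowup.π (C.comap f)) := CentreSeq.isIso_blowup_π_of_eq_top htop
      have hlist := comapExp_transformExp_of_comap_eq_top f E T m C htop
      -- the upstairs list after the trivial step has acquired one empty member
      have hnt : nonTop (comapExp (transformExp E (blowup.π C) T m) (blowup.comapMap C f)) =
          nonTop (comapExp (comapExp E f) (blowup.π (C.comap f))) := by
        rw [hlist, nonTop_append]
        have h0 : nonTop ([(⊤, weightOf E T - m)] : List ((blowup (C.comap f)).IdealSheafData × ℕ)) = [] := by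
          classical
          unfold nonTop
          exact List.filter_cons_of_neg (by simp)
        rw [h0, List.append_nil]
      have hsnc₂ : HasSNC (boundaryOf (comapExp (comapExp E f) (blowup.π (C.comap f)))) := hsnc₁'.of_nonTop_eq hnt
      rw [monoSeq_comap_of_surjective (blowup.π (C.comap f)) hE' hsnc₂ hm,
        ← monoSeq_eq_of_nonTop_eq hsnc₁' hm hnt]
      exact ih₁

/-- **Kollár's form of the second bullet of 3.34.1**: deleting the empty blow-ups from the
pull-back of the canonical sequence gives the canonical sequence of the pulled-back data.
[cite: Kollar2007, 3.34.1 (p. 131)] -/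
theorem prune_comap_monoSeq {X' : Scheme.{u}} (f : X' ⟶ X) [Flat f]
    [IsLocallyNoetherian X] [IsLocallyNoetherian X'] {E : List (X.IdealSheafData × ℕ)}
    (hE : HasSNC (boundaryOf E)) (hE' : HasSNC (boundaryOf (comapExp E f))) {m : ℕ} (hm : 1 ≤ m) :
    ((monoSeq X E m).comap f).prune = monoSeq X' (comapExp E f) m :=
  (comap_monoSeq_isExtensionOf f hE hE' hm).prune_eq (noEmptyCentres_monoSeq hE' hm)

/-- **Restriction to an open subscheme**: the restricted canonical sequence is an extension of
the canonical sequence of the restricted data (BGMW Thm. 8.0.5 (2) for the monomial step).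
[cite: BierstoneGrigorievMilmanWlodarczyk2011, Thm. 8.0.5 (2), Def. 3.1.5 Remark (1)] -/
theorem restrict_monoSeq_isExtensionOf {U : Scheme.{u}} (j : U ⟶ X) [IsOpenImmersion j]
    [IsLocallyNoetherian X] [IsLocallyNoetherian U] {E : List (X.IdealSheafData × ℕ)}
    (hE : HasSNC (boundaryOf E)) (hE' : HasSNC (boundaryOf (comapExp E j))) {m : ℕ} (hm : 1 ≤ m) :
    ((monoSeq X E m).restrict j).IsExtensionOf (monoSeq U (comapExp E j) m) := by
  rw [CentreSeq.restrict_eq_comap]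
  exact comap_monoSeq_isExtensionOf j hE hE' hm

end Functoriality

end Literature.AlgebraicGeometry.Resolution
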